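import Summits.BirchSwinnertonDyer.Rank1Residual.Additive.CyclotomicThreeMultiplicativeReduction
import Literature.NumberTheory.EllipticCurves.QuadraticTwistLocalPolynomialProofs
import Literature.NumberTheory.EllipticCurves.QuadraticTwistPadicReduction
import Literature.NumberTheory.EllipticCurves.NeronComponentIndexSplitProofs
import Literature.NumberTheory.EllipticCurves.NonsplitProofs
import Literature.NumberTheory.EllipticCurves.QuadraticTwistLFunctionProofs
import Literature.NumberTheory.EllipticCurves.LocalPointsIntegersSubgroup
import HarnessLib

/-!
# The quadratic twist at a multiplicative prime `ℓ ∤ 2d`: same type, same `n`, splitness by the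
# Legendre symbol `(d/ℓ)`, and the Tamagawa numbers (row T-MIL-ODD, FILE A-2a; seat n1011-p01 GEN 5)

HONEST FRAMING (cell `b2b-bsdres`, run/shared/lean/b2b/bsd-rank1-residual/, verbatim in every
file): the goal of the cell is to DELETE the COMBINATION-SHAPED residual classes of the
Birch–Swinnerton-Dyer formula for ALL analytic-rank `≤ 1` elliptic curves over `ℚ` — "full BSD
formula for every rank `≤ 1` curve in class `C`" assembled STRICTLY from published theorems — so
that the rank-`≤ 1` remainder becomes exactly the CONSTRUCTION-SHAPED classes, which are TYPED
(missing-input `Prop`s), NOT attempted. This is not "finishing BSD". Sub-classes X3♯(M) / X4(M)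
(additive, potentially multiplicative prime; base-change-and-descend): a RESEARCH ROUTE; they stay
CONSTRUCTION-SHAPED; nothing is booked by this file; no mark / label moved. THEOREMS ONLY: no
definition, no named fact, no `sorry`.

## What and why (row T-MIL-ODD, `cells/n1011/skel/T-MIL-ODD.md`, §1 (M), twist side)

In the odd part of Milne's quadratic BSD-quotient identity (`hWR` of `AdditivePotMult/Descent`,
A65/A73; `hodd` of `bsdRHS_baseChange_quadratic_of_padicValRat`) the twist `W^{(d)}`, `d = d_K`,
enters through `∏_ℓ c_ℓ(Wd)`. This file gives the entries at a MULTIPLICATIVE place `v` of `V/ℚ`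
(globally minimal) over an ODD prime `ℓ` NOT dividing the integer `d` (unramified twist):

* `hasMultiplicativeReductionAt_quadraticTwist_of_not_dvd`,
  `ordMinimalDiscriminant_quadraticTwist_of_not_dvd` — `V^{(d)}` is again multiplicative at `v`
  with the same `n = ord_v Δ_min` (the explicit model `V^{(d)} ⊗ ℚ_v` is minimal: tree
  `isMinimal_quadraticTwist`);
* `hasSplitMultiplicativeReductionAt_quadraticTwist_iff_of_not_dvd` — **`V^{(d)}` is split at `v`
  iff (`d` is a square mod `ℓ`) ⟺ (`V` is split at `v`)** (tree, DVR form: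
  `hasSplitMultiplicativeReduction_quadraticTwist_iff`; here in the number-field currency with the
  Legendre condition as `IsSquare (d : ZMod ℓ)`);
* Tamagawa: `localTamagawaNumber_quadraticTwist_eq_ordMinimalDiscriminant_of_split`,
  `localTamagawaNumber_quadraticTwist_eq_one_or_two_of_not_split`, and for an odd prime `p` the
  PAIR identity `padicValNat_localTamagawaNumber_add_quadraticTwist_of_not_isSquare`:
  **`v_p(c_v(V)) + v_p(c_v(V^{(d)})) = v_p(n)` when `(d/ℓ) = −1`** (exactly one of the two is split)
  and `…_of_isSquare`: `= 2·[split]·v_p(n)` when `(d/ℓ) = +1` — the twist-side halves of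
  (L_ℓ)@p at an inert / split multiplicative `ℓ` (skeleton §1 (M)).

In print: Kramer, Trans. AMS 264 (1981) §2 Prop. 2 (twisted Tate curve); Silverman *AEC* X.2
Prop. 2.4, Ex. 10.16, VII.5.1 (b); *ATAEC* IV.9.4 Step 2. HONEST LIMITS: TOOL theorems; `ℓ` odd and
`ℓ ∤ d` only (the `ℓ = 2` unit twist needs the `twistModel` route; the square-in-`ℚ_ℓ` case is the
tree's `hasSplitMultiplicativeReductionAtPrime_quadraticTwist_iff`; the ramified twist `ℓ ∣ d` is
FILE A-2b); closes no class, discharges no fact by itself; nothing about any curve is asserted.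
-/

noncomputable section

open scoped Classical NumberField

open Polynomial WeierstrassCurve NumberField IsDedekindDomain Rat.HeightOneSpectrum
  Literature.NumberTheory.EllipticCurves Literature.NumberTheory.EllipticCurves.Rank1Residual
  Literature.NumberTheory.GaloisRepresentations Field IsLocalRing
  Summit.BirchSwinnertonDyer.Rank1Residual.Additive

namespace Summit.BirchSwinnertonDyer.Rank1Residual.AdditivePotMult

/-! ## §1 The unit `d` in `𝒪_v` and the twist of `V ⊗ ℚ_v` -/

section Setup

variable (v : HeightOneSpectrum (𝓞 ℚ))

/-- `2` is a unit of `𝒪_v` at a place of odd residue characteristic. [folklore] -/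
theorem isUnit_two_adicCompletionIntegers (hv2 : (primesEquiv v : ℕ) ≠ 2) :
    IsUnit (2 : v.adicCompletionIntegers ℚ) := by
  have h2 : ¬ ((primesEquiv v : ℕ) : ℤ) ∣ (2 : ℤ) := by
    intro h
    have h' : (primesEquiv v : ℕ) ∣ 2 := by exact_mod_cast h
    exact hv2 ((Nat.prime_dvd_prime_iff_eq (primesEquiv v).2 Nat.prime_two).mp h')
  simpa using isUnit_adicCompletionIntegers_intCast v h2

/-- The residue class of the integer `d` in `κ(𝒪_v) ≅ ℤ/ℓ` is a square iff `d mod ℓ` is a square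
in `ZMod ℓ` (transport along the unique ring isomorphism). [folklore] -/
theorem isSquare_residue_intCast_iff (d : ℤ) :
    IsSquare (residue (v.adicCompletionIntegers ℚ) (d : v.adicCompletionIntegers ℚ)) ↔
      IsSquare ((d : ℤ) : ZMod (primesEquiv v : ℕ)) := by
  haveI : Fact (primesEquiv v : ℕ).Prime := ⟨(primesEquiv v).2⟩
  have hcard : Nat.card (ResidueField (v.adicCompletionIntegers ℚ)) = (primesEquiv v : ℕ) :=
    WeierstrassCurve.natCard_residueField_adicCompletionIntegers v
  haveI : Finite (ResidueField (v.adicCompletionIntegers ℚ)) :=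
    Nat.finite_of_card_ne_zero (by rw [hcard]; exact (primesEquiv v).2.ne_zero)
  letI : Fintype (ResidueField (v.adicCompletionIntegers ℚ)) := Fintype.ofFinite _
  have hcard' : Fintype.card (ResidueField (v.adicCompletionIntegers ℚ)) = (primesEquiv v : ℕ) := by
    rw [Fintype.card_eq_nat_card, hcard]
  let e : ZMod (primesEquiv v : ℕ) ≃+* ResidueField (v.adicCompletionIntegers ℚ) :=
    ZMod.ringEquivOfPrime _ (primesEquiv v).2 hcard'
  have he : e ((d : ℤ) : ZMod (primesEquiv v : ℕ)) =
      residue (v.adicCompletionIntegers ℚ) (d : v.adicCompletionIntegers ℚ) := by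
    rw [map_intCast, map_intCast]
  rw [← he]
  constructor
  · rintro ⟨r, hr⟩
    refine ⟨e.symm r, e.injective ?_⟩
    rw [hr, map_mul, RingEquiv.apply_symm_apply]
  · rintro ⟨r, hr⟩
    exact ⟨e r, by rw [hr, map_mul]⟩

end Setup

/-! ## §2 The unit twist at an odd multiplicative place: type, `n`, splitness -/

section UnitTwist

variable (V : WeierstrassCurve ℚ) [V.IsElliptic] [V.IsGloballyMinimal] (v : HeightOneSpectrum (𝓞 ℚ))

/-- **The unit twist at an odd multiplicative place, on minimal models.** For `V/ℚ` globally
minimal, `v` over an odd prime `ℓ ∤ d`: with `X = V ⊗ ℚ_v` (minimal over `𝒪_v`) and the unit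
`d ∈ 𝒪_vˣ`, the model `X^{(d)} = V^{(d)} ⊗ ℚ_v` is minimal (tree `isMinimal_quadraticTwist`), and
the chosen local minimal models of `V` and `V^{(d)}` at `v` are `𝒪_v`-isomorphic to `X`, `X^{(d)}`;
hence: `V^{(d)}` multiplicative at `v` iff `V` is, and then `V^{(d)}` is SPLIT at `v` iff
(`d̄ ∈ κ(v)` is a square ⟺ `V` is split at `v`), with the Legendre condition read in `ZMod ℓ`.
Silverman *AEC* X.2 Prop. 2.4 / Ex. 10.16; tree `hasSplitMultiplicativeReduction_quadraticTwist_iff`.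
[cite: SilvermanAEC2009, VII.5 Prop. 5.1(b) and X.5 Cor. 5.4] -/
theorem hasMultiplicativeReductionAt_and_split_iff_quadraticTwist_of_not_dvd
    (hv2 : (primesEquiv v : ℕ) ≠ 2) {d : ℤ} (hd : ¬ ((primesEquiv v : ℕ) : ℤ) ∣ d)
    (hmult : V.HasMultiplicativeReductionAt v) :
    (V.quadraticTwist (d : ℚ)).HasMultiplicativeReductionAt v ∧
      ((V.quadraticTwist (d : ℚ)).ordMinimalDiscriminant v = V.ordMinimalDiscriminant v) ∧
      ((V.quadraticTwist (d : ℚ)).HasSplitMultiplicativeReductionAt v ↔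
        (IsSquare ((d : ℤ) : ZMod (primesEquiv v : ℕ)) ↔ V.HasSplitMultiplicativeReductionAt v)) := by
  haveI : Fact (primesEquiv v : ℕ).Prime := ⟨(primesEquiv v).2⟩
  -- notation and basic objects
  obtain ⟨R, hR⟩ : ∃ R, R = v.adicCompletionIntegers ℚ := ⟨_, rfl⟩
  subst hR
  have hd0 : (d : ℚ) ≠ 0 := by
    rintro h
    exact hd (by rw [Int.cast_eq_zero.mp h]; exact dvd_zero _)
  haveI := V.isElliptic_quadraticTwist hd0
  haveI hXell : (V.baseChange (v.adicCompletion ℚ)).IsElliptic := by rw [baseChange]; infer_instance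
  haveI hXmin : (V.baseChange (v.adicCompletion ℚ)).IsMinimal (v.adicCompletionIntegers ℚ) :=
    IsGloballyMinimal.isMinimalAt V v
  have h2 : IsUnit (2 : v.adicCompletionIntegers ℚ) := isUnit_two_adicCompletionIntegers v hv2
  haveI : NeZero (2 : v.adicCompletion ℚ) := ⟨two_ne_zero_of_isUnit_two _ h2⟩
  obtain ⟨d', hd'⟩ : ∃ d' : (v.adicCompletionIntegers ℚ)ˣ, (d' : v.adicCompletionIntegers ℚ) = d :=
    ⟨(isUnit_adicCompletionIntegers_intCast v hd).unit, IsUnit.unit_spec _⟩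
  -- the twist of the base change is the base change of the twist
  have hcoe : algebraMap (v.adicCompletionIntegers ℚ) (v.adicCompletion ℚ)
      (d' : v.adicCompletionIntegers ℚ) = ((d : ℤ) : v.adicCompletion ℚ) := by
    rw [hd', map_intCast]
  have htw : (V.quadraticTwist (d : ℚ)).baseChange (v.adicCompletion ℚ) =
      (V.baseChange (v.adicCompletion ℚ)).quadraticTwist
        (algebraMap (v.adicCompletionIntegers ℚ) (v.adicCompletion ℚ) d') := by
    rw [baseChange, map_quadraticTwist, baseChange, map_intCast, hcoe]
  haveI hYmin : ((V.baseChange (v.adicCompletion ℚ)).quadraticTwist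
      (algebraMap (v.adicCompletionIntegers ℚ) (v.adicCompletion ℚ) d')).IsMinimal
        (v.adicCompletionIntegers ℚ) :=
    isMinimal_quadraticTwist _ _ h2 d'
  haveI : ((V.quadraticTwist (d : ℚ)).baseChange (v.adicCompletion ℚ)).IsMinimal
      (v.adicCompletionIntegers ℚ) := by rw [htw]; exact hYmin
  have hΔX : (V.baseChange (v.adicCompletion ℚ)).Δ ≠ 0 := (V.baseChange (v.adicCompletion ℚ)).isUnit_Δ.ne_zero
  have hΔY : ((V.quadraticTwist (d : ℚ)).baseChange (v.adicCompletion ℚ)).Δ ≠ 0 := by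
    haveI : ((V.quadraticTwist (d : ℚ)).baseChange (v.adicCompletion ℚ)).IsElliptic := by
      rw [baseChange]; infer_instance
    exact ((V.quadraticTwist (d : ℚ)).baseChange (v.adicCompletion ℚ)).isUnit_Δ.ne_zero
  -- the chosen local minimal models are `D • X`, `D' • Y`
  obtain ⟨D, hD⟩ : ∃ D : VariableChange (v.adicCompletion ℚ),
      V.localMinimalModel v = D • V.baseChange (v.adicCompletion ℚ) := ⟨_, rfl⟩
  obtain ⟨D', hD'⟩ : ∃ D' : VariableChange (v.adicCompletion ℚ),
      (V.quadraticTwist (d : ℚ)).localMinimalModel v =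
        D' • (V.quadraticTwist (d : ℚ)).baseChange (v.adicCompletion ℚ) := ⟨_, rfl⟩
  haveI : (D • V.baseChange (v.adicCompletion ℚ)).IsMinimal (v.adicCompletionIntegers ℚ) := by
    rw [← hD]; exact instIsMinimalLocalMinimalModel v V
  haveI : (D' • (V.quadraticTwist (d : ℚ)).baseChange (v.adicCompletion ℚ)).IsMinimal
      (v.adicCompletionIntegers ℚ) := by
    rw [← hD']; exact instIsMinimalLocalMinimalModel v (V.quadraticTwist (d : ℚ))
  -- `X` is multiplicative
  have hmultX : (V.baseChange (v.adicCompletion ℚ)).HasMultiplicativeReduction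
      (v.adicCompletionIntegers ℚ) := by
    have h := hmult
    unfold HasMultiplicativeReductionAt at h
    rwa [hD, hasMultiplicativeReduction_iff_of_isMinimal_of_eq_smul _ rfl hΔX] at h
  have hmultY := (hasMultiplicativeReduction_quadraticTwist_iff (v.adicCompletionIntegers ℚ)
    (X := V.baseChange (v.adicCompletion ℚ)) (d := d')).mpr hmultX
  refine ⟨?_, ?_, ?_⟩
  · unfold HasMultiplicativeReductionAt
    rw [hD', hasMultiplicativeReduction_iff_of_isMinimal_of_eq_smul _ rfl hΔY, htw]
    exact hmultY
  · -- both minimal discriminants are read on minimal equations with `Δ(Y) = d⁶ Δ(X)`, `v(d) = 0`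
    have hminQ : (V.quadraticTwist (d : ℚ)).IsMinimalAt v := by
      unfold IsMinimalAt; infer_instance
    have h1 := valuation_Δ_eq_of_isMinimalAt_holds v (V.quadraticTwist (d : ℚ)) hminQ
    have h2' := valuation_Δ_eq_of_isMinimalAt_holds v V (IsGloballyMinimal.isMinimalAt V v)
    have hdv : v.valuation ℚ (d : ℚ) = 1 := valuation_ringOfIntegers_intCast_eq_one v hd
    rw [quadraticTwist_Δ, map_mul, map_pow, hdv, one_pow, one_mul, h2', WithZero.exp_inj,
      neg_inj, Nat.cast_inj] at h1
    exact h1.symm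
  · unfold HasSplitMultiplicativeReductionAt
    rw [hD', hasSplitMultiplicativeReduction_iff_of_isMinimal_of_eq_smul _ rfl hΔY, htw,
      hasSplitMultiplicativeReduction_quadraticTwist_iff _ h2 hmultX, hd',
      isSquare_residue_intCast_iff, hD, hasSplitMultiplicativeReduction_iff_of_isMinimal_of_eq_smul _ rfl hΔX]

end UnitTwist

/-! ## §3 The Tamagawa numbers of `V` and `V^{(d)}` at `v`, and the odd-`p` pair identities -/

section Tamagawa

variable (V : WeierstrassCurve ℚ) [V.IsElliptic] [V.IsGloballyMinimal] (v : HeightOneSpectrum (𝓞 ℚ))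

/-- The residue field `κ(𝒪_v)` of a place of `ℚ` is finite (it has `ℓ` elements, tree
`WeierstrassCurve.natCard_residueField_adicCompletionIntegers`). [folklore] -/
theorem finite_residueField_adicCompletionIntegers_rat :
    Finite (ResidueField (v.adicCompletionIntegers ℚ)) :=
  Nat.finite_of_card_ne_zero
    (by rw [WeierstrassCurve.natCard_residueField_adicCompletionIntegers v]; exact (primesEquiv v).2.ne_zero)

/-- **`c_v(W) = ord_v Δ_min(W)` or `c_v(W) ∈ {1, 2}` according as the multiplicative place `v` of
`W/ℚ` is split or not** (Tate's algorithm Step 2, tree facts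
`localTamagawaNumber_eq_ordMinimalDiscriminant_of_hasSplitMultiplicativeReductionAt` /
`localTamagawaNumber_of_hasNonsplitMultiplicativeReductionAt_holds`), packaged as the odd-`p`
valuation `v_p(c_v(W)) = [split_v]·v_p(ord_v Δ_min(W))`. [cite: SilvermanATAEC1994, IV.9.4 Step 2 and Cor. IV.9.2(d)] -/
theorem padicValNat_localTamagawaNumber_of_hasMultiplicativeReductionAt (W : WeierstrassCurve ℚ)
    [W.IsElliptic] (p : ℕ) [hp : Fact p.Prime] (hodd : p ≠ 2)
    (hmult : W.HasMultiplicativeReductionAt v) :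
    padicValNat p ((W.baseChange (v.adicCompletion ℚ)).localTamagawaNumber
        (v.adicCompletionIntegers ℚ)) =
      if W.HasSplitMultiplicativeReductionAt v then padicValNat p (W.ordMinimalDiscriminant v)
      else 0 := by
  haveI := finite_residueField_adicCompletionIntegers_rat v
  split_ifs with hs
  · rw [localTamagawaNumber_eq_ordMinimalDiscriminant_of_hasSplitMultiplicativeReductionAt v W hs]
  · rw [localTamagawaNumber_of_hasNonsplitMultiplicativeReductionAt_holds (v := v) (W := W) hmult hs]
    split_ifs
    · haveI : Fact (Nat.Prime 2) := ⟨Nat.prime_two⟩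
      exact padicValNat_primes hodd
    · exact padicValNat_one_right _

/-- **The pair identity at an INERT-type twist: `v_p(c_v(V)) + v_p(c_v(V^{(d)})) = v_p(n)`** for
`V/ℚ` globally minimal multiplicative at the place `v` over an odd prime `ℓ ∤ d` with `d` a
NON-square mod `ℓ`, and any odd prime `p`: exactly one of `V`, `V^{(d)}` is split at `v`
(`hasMultiplicativeReductionAt_and_split_iff_quadraticTwist_of_not_dvd`), the split one has
`c_v = n = ord_v Δ_min` (the same `n` for both) and the other `c_v ∈ {1, 2}`. This is the twist-side
half of (L_ℓ)@p at an inert multiplicative `ℓ` (row T-MIL-ODD §1 (M)); Kramer 1981 Prop. 2.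
[cite: SilvermanAEC2009, VII.5 Prop. 5.1(b) and Exercise 3.5] [cite: SilvermanATAEC1994, IV.9.4 Step 2] -/
theorem padicValNat_localTamagawaNumber_add_quadraticTwist_of_not_isSquare
    (hv2 : (primesEquiv v : ℕ) ≠ 2) {d : ℤ} (hd : ¬ ((primesEquiv v : ℕ) : ℤ) ∣ d)
    (hnsq : ¬ IsSquare ((d : ℤ) : ZMod (primesEquiv v : ℕ)))
    (hmult : V.HasMultiplicativeReductionAt v) (p : ℕ) [hp : Fact p.Prime] (hodd : p ≠ 2) :
    padicValNat p ((V.baseChange (v.adicCompletion ℚ)).localTamagawaNumber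
        (v.adicCompletionIntegers ℚ)) +
      padicValNat p (((V.quadraticTwist (d : ℚ)).baseChange (v.adicCompletion ℚ)).localTamagawaNumber
        (v.adicCompletionIntegers ℚ)) =
      padicValNat p (V.ordMinimalDiscriminant v) := by
  have hd0 : (d : ℚ) ≠ 0 := by
    rintro h
    exact hd (by rw [Int.cast_eq_zero.mp h]; exact dvd_zero _)
  haveI := V.isElliptic_quadraticTwist hd0
  obtain ⟨hmultd, hn, hsplit⟩ :=
    hasMultiplicativeReductionAt_and_split_iff_quadraticTwist_of_not_dvd V v hv2 hd hmult
  rw [padicValNat_localTamagawaNumber_of_hasMultiplicativeReductionAt v V p hodd hmult,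
    padicValNat_localTamagawaNumber_of_hasMultiplicativeReductionAt v (V.quadraticTwist (d : ℚ)) p
      hodd hmultd, hn]
  by_cases hs : V.HasSplitMultiplicativeReductionAt v
  · have hsd : ¬ (V.quadraticTwist (d : ℚ)).HasSplitMultiplicativeReductionAt v := by
      rw [hsplit]; exact fun h => hnsq (h.mpr hs)
    simp [hs, hsd]
  · have hsd : (V.quadraticTwist (d : ℚ)).HasSplitMultiplicativeReductionAt v := by
      rw [hsplit]; exact ⟨fun h => absurd h hnsq, fun h => absurd h hs⟩
    simp [hs, hsd]

/-- **The pair identity at a SPLIT-type twist: `v_p(c_v(V^{(d)})) = v_p(c_v(V))`** for `V/ℚ`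
globally minimal multiplicative at `v` over an odd `ℓ ∤ d` with `d` a SQUARE mod `ℓ` (then
`V^{(d)} ≅ V` over `ℚ_v`: same splitness, same `n`), any odd prime `p`. With the base-change side
(FILE A-1b: two places above a split `ℓ`, each with `c_𝔭 = c_ℓ(V)`) this is (L_ℓ)@p at a split
multiplicative `ℓ`. [cite: SilvermanAEC2009, VII.5 Prop. 5.1(b) and X.5 Cor. 5.4] -/
theorem padicValNat_localTamagawaNumber_quadraticTwist_of_isSquare
    (hv2 : (primesEquiv v : ℕ) ≠ 2) {d : ℤ} (hd : ¬ ((primesEquiv v : ℕ) : ℤ) ∣ d)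
    (hsq : IsSquare ((d : ℤ) : ZMod (primesEquiv v : ℕ)))
    (hmult : V.HasMultiplicativeReductionAt v) (p : ℕ) [hp : Fact p.Prime] (hodd : p ≠ 2) :
    padicValNat p (((V.quadraticTwist (d : ℚ)).baseChange (v.adicCompletion ℚ)).localTamagawaNumber
        (v.adicCompletionIntegers ℚ)) =
      padicValNat p ((V.baseChange (v.adicCompletion ℚ)).localTamagawaNumber
        (v.adicCompletionIntegers ℚ)) := by
  have hd0 : (d : ℚ) ≠ 0 := by
    rintro h
    exact hd (by rw [Int.cast_eq_zero.mp h]; exact dvd_zero _)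
  haveI := V.isElliptic_quadraticTwist hd0
  obtain ⟨hmultd, hn, hsplit⟩ :=
    hasMultiplicativeReductionAt_and_split_iff_quadraticTwist_of_not_dvd V v hv2 hd hmult
  rw [padicValNat_localTamagawaNumber_of_hasMultiplicativeReductionAt v V p hodd hmult,
    padicValNat_localTamagawaNumber_of_hasMultiplicativeReductionAt v (V.quadraticTwist (d : ℚ)) p
      hodd hmultd, hn]
  have hiff : (V.quadraticTwist (d : ℚ)).HasSplitMultiplicativeReductionAt v ↔
      V.HasSplitMultiplicativeReductionAt v := by
    rw [hsplit]; exact ⟨fun h => h.mp hsq, fun h => ⟨fun _ => h, fun _ => hsq⟩⟩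
  by_cases hs : V.HasSplitMultiplicativeReductionAt v
  · simp [hs, hiff.mpr hs]
  · simp [hs, show ¬ (V.quadraticTwist (d : ℚ)).HasSplitMultiplicativeReductionAt v from
      fun h => hs (hiff.mp h)]

end Tamagawa

end Summit.BirchSwinnertonDyer.Rank1Residual.AdditivePotMult

end
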